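import Mathlib.NumberTheory.NumberField.Discriminant.Different
import Mathlib.NumberTheory.RamificationInertia.Basic
import Literature.NumberTheory.DiophantineGeometry.GenEllProjLine
import HarnessLib

/-!
# [GenEll] Proposition 1.7 (i): the conductor–different inequality — the number-field engine

S. Mochizuki, *Arithmetic elliptic curves in general position*, Math. J. Okayama Univ. 52 (2010)
[cite: MochizukiGenEll2010] (kurims manuscript, Feb. 2009), Proposition 1.7 (i) pp. 9–10, read on
the page. For a generically finite morphism `φ : Y → Z` of arithmetic surfaces and reduced divisors
`D = φ⁻¹(E)_red ⊆ Y`, `E ⊆ Z`, part (i) asserts, as BD-classes of functions on `U_Y(Q̄)`,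

> `log-cond_E − log-cond_D ≲ log-diff_Y − log-diff_Z ≲ (1 − 1/e) · log-cond_E`,

and the printed proof (p. 10): "the "prime-to-`Σ` portion" of the inequality … follows
immediately from the elementary theory of differents … [again by the elementary theory of
differents] the "portion over `Σ`" of `log-diff_Y − log-diff_Z` is `≥ 0`".

This file isolates and PROVES the number-field content of the LEFT inequality and of the two
quoted remarks, for an arbitrary extension of number fields `L/K` (in the application: the fields
of definition `K = ℚ(φ(y)) ⊆ L = ℚ(y)`). With `logdisc(F) := (1/[F:ℚ])·log |disc F|` (= the tree's
`NFPoint.logDiff`, [GenEll] Def. 1.5 (iii)) and, for a finite set `S` of primes of `K`,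
`cond_K(S) := (1/[K:ℚ])·Σ_{v∈S} log N(v)` (the shape of every log-conductor, Def. 1.5 (iv)):

* `finrank_mul_log_absNorm_sub_sum_log_absNorm_eq`: `[L:K]·log N(v) − Σ_{w∣v} log N(w)
  = Σ_{w∣v} (e_w − 1)·log N(w)` (Mathlib `Ideal.sum_ramification_inertia`,
  `Ideal.absNorm_pow_inertiaDeg`);
* `sum_ramification_log_le_log_absNorm_differentIdeal`: `Σ_{v∈S} Σ_{w∣v} (e_w − 1)·log N(w)
  ≤ log N(𝔡_{L/K})` (each `w^{e_w−1}` divides the relative different — Mathlib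
  `pow_sub_one_dvd_differentIdeal` — and these prime powers are pairwise coprime);
* `log_natAbs_discr_eq`: `log|disc L| = log N(𝔡_{L/K}) + [L:K]·log|disc K|` (transitivity of the
  different, Mathlib `NumberField.natAbs_discr_eq_absNorm_differentIdeal_mul_natAbs_discr_pow`),
  whence `logdisc_le_logdisc` : `logdisc K ≤ logdisc L` ("the portion … is `≥ 0`");
* `cond_sub_cond_le_logdisc_sub_logdisc` — **the conductor–different inequality**: for every
  finite set `T` of primes of `L` containing all primes above `S`,
  `cond_K(S) − cond_L(T) ≤ logdisc L − logdisc K`;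
* `cond_above_le_cond`: `(1/[L:ℚ])·Σ_{v∈S} Σ_{w∣v} log N(w) ≤ cond_K(S)` (normalised conductors do
  not grow in towers);
* `NFPoint.logDiff_le_logDiff_of_ringHom`, `NFPoint.cond_sub_cond_le_logDiff_sub_logDiff`: the
  same for presented points `P`, `Q : NFPoint` of the tree (`GenEllProjLine`) along `P.F →+* Q.F`.

With `S` = the support of the conductor of `x = φ(y)` w.r.t. `E` and `T` = that of `y` w.r.t.
`D ⊇ φ⁻¹(E)_red` (`T` contains every prime above `S`: "`x` meets `E` at `v` ⟹ `y` meets `D` at every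
`w ∣ v`", supplied per curve by the consumer) the main theorem IS the left inequality of Prop. 1.7
(i), constant `0`, no exceptional primes. The RIGHT inequality (exact exponent `e_w − 1` at tame
primes, a bound at wild ones: the tree's local [IUTchIV] Prop. 1.3 `prop13i_holds`/`prop13ii_holds`
plus a local–global dictionary for the different) is NOT proved here. Theorems only; no definitions.
-/

noncomputable section

open NumberField IsDedekindDomain Ideal Module

namespace Literature.NumberTheory.DiophantineGeometry.GenEll

section Engine

variable (K L : Type*) [Field K] [NumberField K] [Field L] [NumberField L] [Algebra K L]

omit [NumberField K] in
/-- A prime factor `w` of `v·𝓞_L` (`v ≠ 0`) is a nonzero prime of `𝓞_L` above `v`. [folklore] -/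
private theorem aux_mem {v : Ideal (𝓞 K)} (hv : v ≠ ⊥) [v.IsMaximal] {w : Ideal (𝓞 L)}
    (hw : w ∈ IsDedekindDomain.primesOverFinset v (𝓞 L)) : w.IsPrime ∧ w.LiesOver v ∧ w ≠ ⊥ :=
  have h := (IsDedekindDomain.mem_primesOverFinset_iff hv (𝓞 L)).mp hw
  ⟨h.1, h.2, ne_bot_of_mem_primesOver hv h⟩

/-- The norm of a nonzero ideal of `𝓞_L` is a positive real number. [folklore] -/
private theorem absNorm_cast_pos {I : Ideal (𝓞 L)} (hI : I ≠ ⊥) : (0 : ℝ) < (absNorm I : ℕ) := by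
  exact_mod_cast Nat.pos_of_ne_zero (by rwa [Ne, Ideal.absNorm_eq_zero_iff])

/-- The norm of a nonzero ideal of `𝓞_L` is `≥ 1`, as a real number. [folklore] -/
private theorem one_le_absNorm_cast {I : Ideal (𝓞 L)} (hI : I ≠ ⊥) : (1 : ℝ) ≤ (absNorm I : ℕ) := by
  exact_mod_cast Nat.one_le_iff_ne_zero.mpr (by rwa [Ne, Ideal.absNorm_eq_zero_iff])

/-- For a prime `w` of `L` above the nonzero prime `v` of `K`: `log N(w) = f_w · log N(v)`
(Mathlib `Ideal.absNorm_pow_inertiaDeg`). [cite: MochizukiGenEll2010, Prop 1.7 (i) p.9] -/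
theorem log_absNorm_eq_inertiaDeg_mul {v : Ideal (𝓞 K)} (hv : v ≠ ⊥) [v.IsMaximal]
    {w : Ideal (𝓞 L)} (hw : w ∈ IsDedekindDomain.primesOverFinset v (𝓞 L)) :
    Real.log (absNorm w : ℝ) = (inertiaDeg' v w : ℝ) * Real.log (absNorm v : ℝ) := by
  obtain ⟨hP, hL, hbot⟩ := aux_mem K L hv hw
  haveI : w.IsMaximal := Ideal.IsPrime.isMaximal hP hbot
  rw [← Ideal.absNorm_pow_inertiaDeg v w, ← Ideal.inertiaDeg'_eq_inertiaDeg v w, Nat.cast_pow,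
    Real.log_pow]

/-- For a nonzero prime `v` of `K`: `[L:K]·log N(v) − Σ_{w∣v} log N(w) = Σ_{w∣v} (e_w − 1)·log N(w)`,
the sums over the primes `w` of `L` above `v` (fundamental identity `Σ_w e_w f_w = [L:K]`, Mathlib
`Ideal.sum_ramification_inertia`). [cite: MochizukiGenEll2010, Prop 1.7 (i) p.9] -/
theorem finrank_mul_log_absNorm_sub_sum_log_absNorm_eq {v : Ideal (𝓞 K)} (hv : v ≠ ⊥)
    [v.IsMaximal] :
    (finrank K L : ℝ) * Real.log (absNorm v : ℝ) -
        ∑ w ∈ IsDedekindDomain.primesOverFinset v (𝓞 L), Real.log (absNorm w : ℝ) =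
      ∑ w ∈ IsDedekindDomain.primesOverFinset v (𝓞 L),
        ((ramificationIdx' v w : ℝ) - 1) * Real.log (absNorm w : ℝ) := by
  have hcast : (finrank K L : ℝ) = ∑ w ∈ IsDedekindDomain.primesOverFinset v (𝓞 L),
      (ramificationIdx' v w : ℝ) * (inertiaDeg' v w : ℝ) := by
    rw [← Ideal.sum_ramification_inertia (R := 𝓞 K) (𝓞 L) K L hv]; push_cast; rfl
  rw [hcast, Finset.sum_mul, ← Finset.sum_sub_distrib]
  refine Finset.sum_congr rfl fun w hw => ?_
  rw [log_absNorm_eq_inertiaDeg_mul K L hv hw]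
  ring

/-- Over a finite set `S` of primes of `K`, the product `Π_{v ∈ S} Π_{w ∣ v} w^{e_w − 1}` divides the
relative different `𝔡_{L/K}` (Mathlib `pow_sub_one_dvd_differentIdeal` prime by prime; distinct
primes give pairwise coprime prime powers). [cite: MochizukiGenEll2010, Prop 1.7 (i) p.10] -/
theorem prod_prod_pow_ramificationIdx_sub_one_dvd_differentIdeal
    (S : Finset (HeightOneSpectrum (𝓞 K))) :
    ∏ v ∈ S, ∏ w ∈ IsDedekindDomain.primesOverFinset v.asIdeal (𝓞 L),
        w ^ (ramificationIdx' v.asIdeal w - 1) ∣ differentIdeal (𝓞 K) (𝓞 L) := by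
  classical
  -- coprimality of the factors attached to distinct primes `w ≠ w'` of `L`
  have hcop : ∀ {w w' : Ideal (𝓞 L)} (a b : ℕ), w.IsPrime → w'.IsPrime → w ≠ ⊥ → w' ≠ ⊥ →
      w ≠ w' → IsCoprime (w ^ a) (w' ^ b) := fun a b hP hP' hb hb' hne =>
    (Ideal.isCoprime_iff_sup_eq.mpr
      ((Ideal.IsPrime.isMaximal hP hb).coprime_of_ne (Ideal.IsPrime.isMaximal hP' hb') hne)).pow
  refine Finset.prod_dvd_of_coprime ?_ fun v _ => Finset.prod_dvd_of_coprime ?_ fun w hw => ?_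
  · intro v _ v' _ hne
    refine IsCoprime.prod_left fun w hw => IsCoprime.prod_right fun w' hw' => ?_
    obtain ⟨hP, hL, hb⟩ := aux_mem K L v.ne_bot hw
    obtain ⟨hP', hL', hb'⟩ := aux_mem K L v'.ne_bot hw'
    refine hcop _ _ hP hP' hb hb' fun h => hne ?_
    ext1
    rw [Ideal.over_def w v.asIdeal, Ideal.over_def w' v'.asIdeal, h]
  · intro w hw w' hw' hne
    obtain ⟨hP, -, hb⟩ := aux_mem K L v.ne_bot hw
    obtain ⟨hP', -, hb'⟩ := aux_mem K L v.ne_bot hw'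
    exact hcop _ _ hP hP' hb hb' hne
  · haveI := v.isMaximal
    haveI : w.IsPrime := (aux_mem K L v.ne_bot hw).1
    exact pow_sub_one_dvd_differentIdeal (A := 𝓞 K) w (ramificationIdx' v.asIdeal w) v.ne_bot
      ((Ideal.dvd_iff_le).mpr Ideal.le_pow_ramificationIdx')

/-- `Σ_{v∈S} Σ_{w∣v} (e_w − 1)·log N(w) ≤ log N(𝔡_{L/K})`: the norm of the relative different is at
least the norm of `Π_v Π_w w^{e_w − 1}`. [cite: MochizukiGenEll2010, Prop 1.7 (i) p.10] -/
theorem sum_ramification_log_le_log_absNorm_differentIdeal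
    (S : Finset (HeightOneSpectrum (𝓞 K))) :
    ∑ v ∈ S, ∑ w ∈ IsDedekindDomain.primesOverFinset v.asIdeal (𝓞 L),
        ((ramificationIdx' v.asIdeal w : ℝ) - 1) * Real.log (absNorm w : ℝ) ≤
      Real.log (absNorm (differentIdeal (𝓞 K) (𝓞 L)) : ℝ) := by
  classical
  set J : Ideal (𝓞 L) := ∏ v ∈ S, ∏ w ∈ IsDedekindDomain.primesOverFinset v.asIdeal (𝓞 L),
    w ^ (ramificationIdx' v.asIdeal w - 1) with hJ
  -- `N(J) ∣ N(𝔡)` and `N(𝔡) ≠ 0`, so `N(J) ≤ N(𝔡)`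
  have hNdvd : absNorm J ∣ absNorm (differentIdeal (𝓞 K) (𝓞 L)) := Ideal.absNorm_dvd_absNorm_of_le
    (Ideal.le_of_dvd (prod_prod_pow_ramificationIdx_sub_one_dvd_differentIdeal K L S))
  have hNpos : 0 < absNorm (differentIdeal (𝓞 K) (𝓞 L)) :=
    Nat.pos_of_ne_zero (by rw [Ne, Ideal.absNorm_eq_zero_iff]; exact differentIdeal_ne_bot)
  have hle : (absNorm J : ℝ) ≤ absNorm (differentIdeal (𝓞 K) (𝓞 L)) := by
    exact_mod_cast Nat.le_of_dvd hNpos hNdvd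
  -- the norm of each factor, as a positive real, and its logarithm
  have hfac : ∀ v ∈ S, ∀ w ∈ IsDedekindDomain.primesOverFinset v.asIdeal (𝓞 L),
      (0 : ℝ) < (absNorm (w ^ (ramificationIdx' v.asIdeal w - 1)) : ℕ) ∧
        Real.log ((absNorm (w ^ (ramificationIdx' v.asIdeal w - 1)) : ℕ) : ℝ) =
          ((ramificationIdx' v.asIdeal w : ℝ) - 1) * Real.log (absNorm w : ℝ) := by
    intro v _ w hw
    obtain ⟨hP, hL, hb⟩ := aux_mem K L v.ne_bot hw
    have he : 1 ≤ ramificationIdx' v.asIdeal w := Nat.one_le_iff_ne_zero.mpr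
      (Ideal.IsDedekindDomain.ramificationIdx'_ne_zero_of_liesOver w v.ne_bot)
    rw [map_pow, Nat.cast_pow, Real.log_pow, Nat.cast_sub he, Nat.cast_one]
    exact ⟨pow_pos (absNorm_cast_pos L hb) _, rfl⟩
  have hJpos : (0 : ℝ) < absNorm J := by
    rw [hJ, map_prod, Nat.cast_prod]
    refine Finset.prod_pos fun v hv => ?_
    rw [map_prod, Nat.cast_prod]
    exact Finset.prod_pos fun w hw => (hfac v hv w hw).1
  have hlogJ : Real.log (absNorm J : ℝ) = ∑ v ∈ S,
      ∑ w ∈ IsDedekindDomain.primesOverFinset v.asIdeal (𝓞 L),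
        ((ramificationIdx' v.asIdeal w : ℝ) - 1) * Real.log (absNorm w : ℝ) := by
    rw [hJ, map_prod, Nat.cast_prod, Real.log_prod]
    · refine Finset.sum_congr rfl fun v hv => ?_
      rw [map_prod, Nat.cast_prod, Real.log_prod]
      · exact Finset.sum_congr rfl fun w hw => (hfac v hv w hw).2
      · exact fun w hw => (hfac v hv w hw).1.ne'
    · intro v hv
      rw [map_prod, Nat.cast_prod]
      exact (Finset.prod_pos fun w hw => (hfac v hv w hw).1).ne'
  rw [← hlogJ]
  exact Real.log_le_log hJpos hle

/-- `log|disc L| = log N(𝔡_{L/K}) + [L:K]·log|disc K|` (Mathlib: transitivity of the different,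
`NumberField.natAbs_discr_eq_absNorm_differentIdeal_mul_natAbs_discr_pow`).
[cite: MochizukiGenEll2010, Prop 1.7 (i) p.10] -/
theorem log_natAbs_discr_eq :
    Real.log ((discr L).natAbs : ℝ) = Real.log (absNorm (differentIdeal (𝓞 K) (𝓞 L)) : ℝ) +
      (finrank K L : ℝ) * Real.log ((discr K).natAbs : ℝ) := by
  have h :=
    NumberField.natAbs_discr_eq_absNorm_differentIdeal_mul_natAbs_discr_pow K (𝓞 K) L (𝓞 L)
  have hD : (0 : ℝ) < absNorm (differentIdeal (𝓞 K) (𝓞 L)) :=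
    absNorm_cast_pos L differentIdeal_ne_bot
  have hK : (0 : ℝ) < (discr K).natAbs := by exact_mod_cast Int.natAbs_pos.mpr (discr_ne_zero K)
  rw [h, Nat.cast_mul, Nat.cast_pow, Real.log_mul hD.ne' (pow_pos hK _).ne', Real.log_pow]

/-- **Log-discriminants do not decrease in towers** ("the portion of `log-diff_Y − log-diff_Z` is
`≥ 0`", [GenEll] p. 10): `(1/[K:ℚ])·log|disc K| ≤ (1/[L:ℚ])·log|disc L|`.
[cite: MochizukiGenEll2010, Prop 1.7 (i) p.10] -/
theorem logdisc_le_logdisc :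
    (finrank ℚ K : ℝ)⁻¹ * Real.log ((discr K).natAbs : ℝ) ≤
      (finrank ℚ L : ℝ)⁻¹ * Real.log ((discr L).natAbs : ℝ) := by
  have hKpos : (0 : ℝ) < finrank ℚ K := by exact_mod_cast finrank_pos
  have hKL : (0 : ℝ) < finrank K L := by exact_mod_cast finrank_pos
  have htower : (finrank ℚ L : ℝ) = finrank ℚ K * finrank K L := by
    exact_mod_cast (finrank_mul_finrank ℚ K L).symm
  have hD := Real.log_nonneg (one_le_absNorm_cast L (differentIdeal_ne_bot (A := 𝓞 K) (B := 𝓞 L)))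
  rw [log_natAbs_discr_eq K L, htower, mul_inv, mul_add, show (finrank ℚ K : ℝ)⁻¹ *
      (finrank K L : ℝ)⁻¹ * ((finrank K L : ℝ) * Real.log ((discr K).natAbs)) =
        (finrank ℚ K : ℝ)⁻¹ * Real.log ((discr K).natAbs) by field_simp]
  have : 0 ≤ (finrank ℚ K : ℝ)⁻¹ * (finrank K L : ℝ)⁻¹ *
      Real.log (absNorm (differentIdeal (𝓞 K) (𝓞 L)) : ℝ) := by positivity
  linarith

/-! ## The conductor–different inequality -/

/-- **Prime-indexed form**: for a finite set `S` of primes of `K`,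
`[L:K]·Σ_{v∈S} log N(v) − Σ_{v∈S} Σ_{w∣v} log N(w) ≤ log|disc L| − [L:K]·log|disc K|` (`= log N(𝔡_{L/K})`).
[cite: MochizukiGenEll2010, Prop 1.7 (i) p.10] -/
theorem finrank_mul_sum_log_sub_sum_sum_log_le (S : Finset (HeightOneSpectrum (𝓞 K))) :
    (finrank K L : ℝ) * ∑ v ∈ S, Real.log (absNorm v.asIdeal : ℝ) -
        ∑ v ∈ S, ∑ w ∈ IsDedekindDomain.primesOverFinset v.asIdeal (𝓞 L),
          Real.log (absNorm w : ℝ) ≤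
      Real.log ((discr L).natAbs : ℝ) - (finrank K L : ℝ) * Real.log ((discr K).natAbs : ℝ) := by
  have h1 : (finrank K L : ℝ) * ∑ v ∈ S, Real.log (absNorm v.asIdeal : ℝ) -
        ∑ v ∈ S, ∑ w ∈ IsDedekindDomain.primesOverFinset v.asIdeal (𝓞 L),
          Real.log (absNorm w : ℝ) =
      ∑ v ∈ S, ∑ w ∈ IsDedekindDomain.primesOverFinset v.asIdeal (𝓞 L),
        ((ramificationIdx' v.asIdeal w : ℝ) - 1) * Real.log (absNorm w : ℝ) := by
    rw [Finset.mul_sum, ← Finset.sum_sub_distrib]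
    refine Finset.sum_congr rfl fun v _ => ?_
    haveI := v.isMaximal
    exact finrank_mul_log_absNorm_sub_sum_log_absNorm_eq K L v.ne_bot
  rw [h1, log_natAbs_discr_eq K L, add_sub_cancel_right]
  exact sum_ramification_log_le_log_absNorm_differentIdeal K L S

open scoped Classical in
/-- The primes `w` of `L` with `w ∩ 𝓞_K = v`, taken inside any finite set `T` containing all of them,
are in bijection via `asIdeal` with the prime factors of `v·𝓞_L`: sums agree.
[cite: MochizukiGenEll2010, Prop 1.7 (i) p.10] -/
theorem sum_filter_under_eq_sum_primesOverFinset (v : HeightOneSpectrum (𝓞 K))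
    (T : Finset (HeightOneSpectrum (𝓞 L)))
    (hT : ∀ w : HeightOneSpectrum (𝓞 L), w.under (𝓞 K) = v → w ∈ T) (g : Ideal (𝓞 L) → ℝ) :
    ∑ w ∈ T.filter (fun w => w.under (𝓞 K) = v), g w.asIdeal =
      ∑ w ∈ IsDedekindDomain.primesOverFinset v.asIdeal (𝓞 L), g w := by
  refine Finset.sum_nbij (fun w => w.asIdeal) ?_ (fun w _ w' _ h => HeightOneSpectrum.ext h) ?_
    fun w _ => rfl
  · intro w hw
    rw [Finset.mem_filter] at hw
    rw [IsDedekindDomain.mem_primesOverFinset_iff v.ne_bot]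
    exact ⟨w.isPrime, ⟨by rw [← hw.2]; rfl⟩⟩
  · intro P hP
    rw [Finset.mem_coe] at hP
    obtain ⟨hP1, hP2, hPbot⟩ := aux_mem K L v.ne_bot hP
    let w : HeightOneSpectrum (𝓞 L) := ⟨P, hP1, hPbot⟩
    have hw : w.under (𝓞 K) = v := by
      ext1
      change P.under (𝓞 K) = v.asIdeal
      exact (Ideal.over_def P v.asIdeal).symm
    exact ⟨w, by rw [Finset.mem_coe, Finset.mem_filter]; exact ⟨hT w hw, hw⟩, rfl⟩

open scoped Classical in
/-- For a finite set `T` of primes of `L` containing every prime above the primes of `S`: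
`Σ_{v∈S} Σ_{w∣v} log N(w) ≤ Σ_{w∈T} log N(w)`. [cite: MochizukiGenEll2010, Prop 1.7 (i) p.10] -/
theorem sum_sum_log_absNorm_le_sum_of_forall_under (S : Finset (HeightOneSpectrum (𝓞 K)))
    (T : Finset (HeightOneSpectrum (𝓞 L)))
    (hT : ∀ w : HeightOneSpectrum (𝓞 L), w.under (𝓞 K) ∈ S → w ∈ T) :
    ∑ v ∈ S, ∑ w ∈ IsDedekindDomain.primesOverFinset v.asIdeal (𝓞 L), Real.log (absNorm w : ℝ) ≤
      ∑ w ∈ T, Real.log (absNorm w.asIdeal : ℝ) := by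
  calc ∑ v ∈ S, ∑ w ∈ IsDedekindDomain.primesOverFinset v.asIdeal (𝓞 L), Real.log (absNorm w : ℝ)
      = ∑ v ∈ S, ∑ w ∈ T.filter (fun w => w.under (𝓞 K) = v),
          Real.log (absNorm w.asIdeal : ℝ) :=
        Finset.sum_congr rfl fun v hv => (sum_filter_under_eq_sum_primesOverFinset K L v T
          (fun w hw => hT w (hw ▸ hv)) (fun I => Real.log (absNorm I : ℝ))).symm
    _ = ∑ w ∈ T.filter (fun w => w.under (𝓞 K) ∈ S), Real.log (absNorm w.asIdeal : ℝ) := by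
        rw [← Finset.sum_biUnion]
        · congr 1
          ext w
          simp only [Finset.mem_biUnion, Finset.mem_filter]
          exact ⟨fun ⟨v, hv, hwT, hwv⟩ => ⟨hwT, hwv ▸ hv⟩, fun ⟨hwT, hwS⟩ => ⟨_, hwS, hwT, rfl⟩⟩
        · intro v _ v' _ hne
          simp only [Function.onFun]
          rw [Finset.disjoint_filter]
          exact fun w _ h h' => hne (h.symm.trans h')
    _ ≤ ∑ w ∈ T, Real.log (absNorm w.asIdeal : ℝ) :=
        Finset.sum_le_sum_of_subset_of_nonneg (Finset.filter_subset _ _)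
          fun w _ _ => Real.log_nonneg (one_le_absNorm_cast L w.ne_bot)

/-- **The conductor–different inequality** ([GenEll] Prop. 1.7 (i), left inequality, number-field
content): for an extension of number fields `L/K`, a finite set `S` of primes of `K` and a finite set
`T` of primes of `L` containing every prime above `S`,
`(1/[K:ℚ])Σ_{v∈S} log N(v) − (1/[L:ℚ])Σ_{w∈T} log N(w) ≤ (1/[L:ℚ]) log|disc L| − (1/[K:ℚ]) log|disc K|`
— i.e. `log-cond_E(x) − log-cond_D(y) ≤ log-diff(y) − log-diff(x)` as soon as `y ↦ x` pulls the
support of `E` at `x` back into the support of `D` at `y`; constant `0`, no exceptional primes.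
[cite: MochizukiGenEll2010, Prop 1.7 (i) p.9] -/
theorem cond_sub_cond_le_logdisc_sub_logdisc (S : Finset (HeightOneSpectrum (𝓞 K)))
    (T : Finset (HeightOneSpectrum (𝓞 L)))
    (hT : ∀ w : HeightOneSpectrum (𝓞 L), w.under (𝓞 K) ∈ S → w ∈ T) :
    (finrank ℚ K : ℝ)⁻¹ * ∑ v ∈ S, Real.log (absNorm v.asIdeal : ℝ) -
        (finrank ℚ L : ℝ)⁻¹ * ∑ w ∈ T, Real.log (absNorm w.asIdeal : ℝ) ≤
      (finrank ℚ L : ℝ)⁻¹ * Real.log ((discr L).natAbs : ℝ) -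
        (finrank ℚ K : ℝ)⁻¹ * Real.log ((discr K).natAbs : ℝ) := by
  have hKpos : (0 : ℝ) < finrank ℚ K := by exact_mod_cast finrank_pos
  have hLpos : (0 : ℝ) < finrank ℚ L := by exact_mod_cast finrank_pos
  have hKL : (0 : ℝ) < finrank K L := by exact_mod_cast finrank_pos
  have htower : (finrank ℚ L : ℝ) = finrank ℚ K * finrank K L := by
    exact_mod_cast (finrank_mul_finrank ℚ K L).symm
  have hmain := finrank_mul_sum_log_sub_sum_sum_log_le K L S
  have hsub := sum_sum_log_absNorm_le_sum_of_forall_under K L S T hT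
  have hK : (finrank ℚ K : ℝ)⁻¹ = (finrank ℚ L : ℝ)⁻¹ * finrank K L := by
    rw [htower]; field_simp
  have h3 : (finrank K L : ℝ) * ∑ v ∈ S, Real.log (absNorm v.asIdeal : ℝ) -
      ∑ w ∈ T, Real.log (absNorm w.asIdeal : ℝ) ≤
      Real.log ((discr L).natAbs : ℝ) - (finrank K L : ℝ) * Real.log ((discr K).natAbs : ℝ) := by
    linarith
  have h4 := mul_le_mul_of_nonneg_left h3 (inv_pos.mpr hLpos).le
  have e1 : (finrank ℚ L : ℝ)⁻¹ * (finrank K L : ℝ) * ∑ v ∈ S, Real.log (absNorm v.asIdeal : ℝ) -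
      (finrank ℚ L : ℝ)⁻¹ * ∑ w ∈ T, Real.log (absNorm w.asIdeal : ℝ) =
      (finrank ℚ L : ℝ)⁻¹ * ((finrank K L : ℝ) * ∑ v ∈ S, Real.log (absNorm v.asIdeal : ℝ) -
        ∑ w ∈ T, Real.log (absNorm w.asIdeal : ℝ)) := by ring
  have e2 : (finrank ℚ L : ℝ)⁻¹ * Real.log ((discr L).natAbs : ℝ) -
      (finrank ℚ L : ℝ)⁻¹ * (finrank K L : ℝ) * Real.log ((discr K).natAbs : ℝ) =
      (finrank ℚ L : ℝ)⁻¹ * (Real.log ((discr L).natAbs : ℝ) -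
        (finrank K L : ℝ) * Real.log ((discr K).natAbs : ℝ)) := by ring
  rw [hK, e1, e2]
  exact h4

/-- **Normalised conductors do not increase in towers**: for a finite set `S` of primes of `K`,
`(1/[L:ℚ]) Σ_{v∈S} Σ_{w∣v} log N(w) ≤ (1/[K:ℚ]) Σ_{v∈S} log N(v)` (since `Σ_{w∣v} f_w ≤ [L:K]`).
[cite: MochizukiGenEll2010, Prop 1.7 (i) p.10] -/
theorem cond_above_le_cond (S : Finset (HeightOneSpectrum (𝓞 K))) :
    (finrank ℚ L : ℝ)⁻¹ * ∑ v ∈ S, ∑ w ∈ IsDedekindDomain.primesOverFinset v.asIdeal (𝓞 L),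
        Real.log (absNorm w : ℝ) ≤
      (finrank ℚ K : ℝ)⁻¹ * ∑ v ∈ S, Real.log (absNorm v.asIdeal : ℝ) := by
  have hKpos : (0 : ℝ) < finrank ℚ K := by exact_mod_cast finrank_pos
  have hKL : (0 : ℝ) < finrank K L := by exact_mod_cast finrank_pos
  have htower : (finrank ℚ L : ℝ) = finrank ℚ K * finrank K L := by
    exact_mod_cast (finrank_mul_finrank ℚ K L).symm
  -- per prime: `Σ_{w∣v} log N(w) ≤ [L:K]·log N(v)`, because `Σ_w (e_w − 1)·log N(w) ≥ 0`
  have hv : ∀ v ∈ S, ∑ w ∈ IsDedekindDomain.primesOverFinset v.asIdeal (𝓞 L),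
      Real.log (absNorm w : ℝ) ≤ (finrank K L : ℝ) * Real.log (absNorm v.asIdeal : ℝ) := by
    intro v _
    haveI := v.isMaximal
    have h := finrank_mul_log_absNorm_sub_sum_log_absNorm_eq K L v.ne_bot
    have hnn : 0 ≤ ∑ w ∈ IsDedekindDomain.primesOverFinset v.asIdeal (𝓞 L),
        ((ramificationIdx' v.asIdeal w : ℝ) - 1) * Real.log (absNorm w : ℝ) := by
      refine Finset.sum_nonneg fun w hw => mul_nonneg ?_ ?_
      · obtain ⟨hP, hL, hb⟩ := aux_mem K L v.ne_bot hw
        have he : (1 : ℝ) ≤ ramificationIdx' v.asIdeal w := by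
          exact_mod_cast Nat.one_le_iff_ne_zero.mpr
            (Ideal.IsDedekindDomain.ramificationIdx'_ne_zero_of_liesOver w v.ne_bot)
        linarith
      · exact Real.log_nonneg (one_le_absNorm_cast L (aux_mem K L v.ne_bot hw).2.2)
    linarith
  have hsum : ∑ v ∈ S, ∑ w ∈ IsDedekindDomain.primesOverFinset v.asIdeal (𝓞 L),
      Real.log (absNorm w : ℝ) ≤ (finrank K L : ℝ) * ∑ v ∈ S, Real.log (absNorm v.asIdeal : ℝ) := by
    rw [Finset.mul_sum]; exact Finset.sum_le_sum hv
  rw [htower, mul_inv]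
  calc (finrank ℚ K : ℝ)⁻¹ * (finrank K L : ℝ)⁻¹ *
        ∑ v ∈ S, ∑ w ∈ IsDedekindDomain.primesOverFinset v.asIdeal (𝓞 L), Real.log (absNorm w : ℝ)
      ≤ (finrank ℚ K : ℝ)⁻¹ * (finrank K L : ℝ)⁻¹ *
        ((finrank K L : ℝ) * ∑ v ∈ S, Real.log (absNorm v.asIdeal : ℝ)) :=
        mul_le_mul_of_nonneg_left hsum (by positivity)
    _ = (finrank ℚ K : ℝ)⁻¹ * ∑ v ∈ S, Real.log (absNorm v.asIdeal : ℝ) := by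
        field_simp

end Engine

/-! ## Restatement for presented points (`NFPoint`) along a ring map -/

namespace NFPoint

/-- `log-diff` does not decrease along a map of presenting fields `P.F → Q.F` (the point `Q` is
defined over an extension of the field of `P`): `log-diff(P) ≤ log-diff(Q)`.
[cite: MochizukiGenEll2010, Prop 1.7 (i) p.10] -/
theorem logDiff_le_logDiff_of_ringHom (P Q : NFPoint) (f : P.F →+* Q.F) :
    P.logDiff ≤ Q.logDiff := by
  letI : Algebra P.F Q.F := f.toAlgebra
  rw [logDiff_eq_log_discr, logDiff_eq_log_discr]
  exact logdisc_le_logdisc P.F Q.F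

/-- **The conductor–different inequality for presented points**: for `P`, `Q : NFPoint`, a map of
presenting fields `f : P.F →+* Q.F`, a finite set `S` of primes of `𝓞_{P.F}` and a finite set `T` of
primes of `𝓞_{Q.F}` containing every prime above `S`:
`(1/[P.F:ℚ]) Σ_{v∈S} log N(v) − (1/[Q.F:ℚ]) Σ_{w∈T} log N(w) ≤ log-diff(Q) − log-diff(P)`.
[cite: MochizukiGenEll2010, Prop 1.7 (i) p.9] -/
theorem cond_sub_cond_le_logDiff_sub_logDiff (P Q : NFPoint) (f : P.F →+* Q.F)
    (S : Finset (HeightOneSpectrum (𝓞 P.F))) (T : Finset (HeightOneSpectrum (𝓞 Q.F)))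
    (hT : letI : Algebra P.F Q.F := f.toAlgebra
      ∀ w : HeightOneSpectrum (𝓞 Q.F), w.under (𝓞 P.F) ∈ S → w ∈ T) :
    (P.degree : ℝ)⁻¹ * ∑ v ∈ S, Real.log (absNorm v.asIdeal : ℝ) -
        (Q.degree : ℝ)⁻¹ * ∑ w ∈ T, Real.log (absNorm w.asIdeal : ℝ) ≤
      Q.logDiff - P.logDiff := by
  letI : Algebra P.F Q.F := f.toAlgebra
  rw [logDiff_eq_log_discr, logDiff_eq_log_discr]
  exact cond_sub_cond_le_logdisc_sub_logdisc P.F Q.F S T hT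

end NFPoint

end Literature.NumberTheory.DiophantineGeometry.GenEll

end
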